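import Summits.AtomisticToContinuum.HydrodynamicLimit.Theorems.JParityClosureOddContactSymmetryMaxwellDefectVel
import Summits.AtomisticToContinuum.HydrodynamicLimit.Theorems.JParityClosureOddContactSymmetryKdeDefectPair
import Summits.AtomisticToContinuum.HydrodynamicLimit.Theorems.JParityClosureOddContactSymmetryFluxLeGibbs
import Summits.AtomisticToContinuum.HydrodynamicLimit.Theorems.JParityClosureOddContactSymmetryGibbsFluxLower
import Summits.AtomisticToContinuum.HydrodynamicLimit.Theorems.JParityClosureOddContactSymmetryFixedBallVoid
import Summits.AtomisticToContinuum.HydrodynamicLimit.Theorems.JParityClosureOddContactSymmetryTaggedVoid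
import Summits.AtomisticToContinuum.HydrodynamicLimit.Theorems.JParityClosureOddContactSymmetryMetroMarkRegular
import Literature.MathematicalPhysics.KineticTheory.EnskogRateConstMarkStatics
import Literature.Analysis.FluidPDE.HardSphereAlexander
import HarnessLib

/-!
# P4 `stub_maxwellDefectFlux`: the Metropolis acceptance defect has vanishing relative Gibbs contact flux at the kinetic mesoscale (line `KineticSlabSketch`)

Crux `JParityClosure.OddContactSymmetry` (stmt-AtomisticToContinuum-17722, rev 5), line `KineticSlabSketch`, lead
`prover-line-stmt-AtomisticToContinuum-17722-c2-0` (cycle 3).  The analytic core of the static centring S1a: for `θe > 0` there is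
`σ₀ = min(1/4, σ₀^{void})` such that for `σ < σ₀`, every `ϑ, y > 0`, for `K ≥ K₀` and `N ≥ N₀`,
`flux(ρ_G · (1 − w)) ≤ y · flux(ρ_G)` at the reading scale `r_K = K^{1/4}(N+1)^{-1/3}`.  ASSEMBLY of the landed pieces:
F1 `stub_fluxLeGibbs` (flux ≤ 2 × free-insertion expectation under `G_N`), F2 `stub_gibbsFluxLower` (free-insertion flux ≤ 2 flux),
the rung-0 disintegration `lintegral_localGibbsLaw_rung0` (positions `posGibbsMeasure` ⊗ i.i.d. Maxwellian velocities), the velocity-level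
bound `defectVel_le` (= K1 `stub_kdeDefectPair` on the inserted contact configuration, A1/A2) on the positions whose tagged occupancy within
`r_K/4` exceeds `2 + 2/ρ`, the trivial bound `1 − w ≤ 1` elsewhere, and the tagged void estimate V2 `stub_taggedVoid_of stub_fixedBallVoid`
for the exceptional positions; Alexander's flow (`HardSphereFlow.nonempty_torus_holds`) only types the Gibbs law.
-/

noncomputable section

open scoped BigOperators Classical InnerProductSpace ENNReal Topology
open Set MeasureTheory Filter Function
open Literature.Analysis.FluidPDE Literature.MathematicalPhysics.KineticTheory

namespace Summit.AtomisticToContinuum.HydrodynamicLimit.Theorems.OddContactSymmetryKineticSlab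

/-- **P4 `stub_maxwellDefectFlux`** (registered stub of the skeleton): the Metropolis acceptance defect of the crux's weight has relative
Gibbs contact flux `≤ y` at the kinetic mesoscale, eventually in `K` and `N`.  See the module docstring for the assembly. [folklore] -/
theorem stub_maxwellDefectFlux :
    ∀ θe : ℝ, 0 < θe → ∃ σ₀ : ℝ, 0 < σ₀ ∧ ∀ σ : ℝ, 0 < σ → σ < σ₀ → ∀ ϑ : ℝ, 0 < ϑ → ∀ y : ℝ, 0 < y →
    ∃ K₀ : ℕ, ∀ K : ℕ, K₀ ≤ K → ∃ N₀ : ℕ, ∀ N : ℕ, N₀ ≤ N →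
      outgoingCollisionFlux (hsDiameter σ N) (N + 1)
          (fun w i j => ENNReal.ofReal (canonicalDensity (Torus.geometry (Fin 3)) (hsDiameter σ N) (N + 1)
              (localGibbsProfile (fun _ => 1) (fun _ => 0) (fun _ => θe)) w) *
            ENNReal.ofReal (1 - metroOddMark σ N (fun _ => 1) (fun _ => 1) (fun _ => 1)
              ((K : ℝ) ^ (1 / 4 : ℝ) * ((N + 1 : ℕ) : ℝ) ^ (-(1 / 3 : ℝ))) ϑ 0 w i j)) ≤
        ENNReal.ofReal y * outgoingCollisionFlux (hsDiameter σ N) (N + 1)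
          (fun w _ _ => ENNReal.ofReal (canonicalDensity (Torus.geometry (Fin 3)) (hsDiameter σ N) (N + 1)
              (localGibbsProfile (fun _ => 1) (fun _ => 0) (fun _ => θe)) w)) := by
  intro θe hθe
  obtain ⟨σV, hσV, hV⟩ := stub_taggedVoid_of stub_fixedBallVoid
  refine ⟨min (1 / 4) σV, lt_min (by norm_num) hσV, ?_⟩
  intro σ hσ hσlt ϑ hϑ y hy
  have hσ4 : σ ≤ 1 / 4 := hσlt.le.trans (min_le_left _ _)
  have hσV' : σ ≤ σV := hσlt.le.trans (min_le_right _ _)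
  have hσ2 : σ < 1 / 2 := by linarith
  obtain ⟨B, hB0, hKB⟩ := stub_kdeDefectPair hθe hϑ
  -- Step 0: constants.  The ratio threshold `ρs`, the K1 level `Bp = B(√ρs + ρs) ≤ y/8`, the void level `y₂ = y/8`.
  set a : ℝ := y / (16 * (B + 1)) with ha_def
  have ha0 : 0 < a := by positivity
  set ρs : ℝ := min 1 (a ^ 2) with hρs
  have hρs0 : 0 < ρs := lt_min one_pos (by positivity)
  have hρs1 : ρs ≤ 1 := min_le_left _ _
  have hsqrt : Real.sqrt ρs ≤ a := by
    rw [Real.sqrt_le_left ha0.le]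
    exact min_le_right _ _
  have hρsq : ρs ≤ Real.sqrt ρs := by
    have h := Real.sqrt_le_sqrt hρs1
    rw [Real.sqrt_one] at h
    calc ρs = Real.sqrt ρs * Real.sqrt ρs := (Real.mul_self_sqrt hρs0.le).symm
      _ ≤ Real.sqrt ρs * 1 := mul_le_mul_of_nonneg_left h (Real.sqrt_nonneg _)
      _ = Real.sqrt ρs := mul_one _
  set Bp : ℝ := B * (Real.sqrt ρs + ρs) with hBp
  have hBp0 : 0 ≤ Bp := by positivity
  have hBpy : Bp ≤ y / 8 := by
    have h1 : Real.sqrt ρs + ρs ≤ 2 * a := by linarith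
    have h2 : B * (2 * a) ≤ y / 8 := by
      rw [ha_def]
      have hB1 : 0 < B + 1 := by positivity
      rw [show B * (2 * (y / (16 * (B + 1)))) = (B / (B + 1)) * (y / 8) by field_simp; ring]
      have : B / (B + 1) ≤ 1 := by rw [div_le_one hB1]; linarith
      exact mul_le_of_le_one_left (by positivity) this
    exact (mul_le_mul_of_nonneg_left h1 hB0).trans h2
  set y₂ : ℝ := y / 8 with hy₂
  have hy₂0 : 0 < y₂ := by positivity
  set nstar : ℝ := 2 + 2 / ρs with hnstar
  have hnstar2 : 2 < nstar := by have := div_pos two_pos hρs0; linarith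
  obtain ⟨n₀, hn₀⟩ := hV hσ hσV' y₂ hy₂0
  -- Step 1: the slab threshold `K₀ = M⁴`
  set M : ℕ := ⌈4096 * σ + 32768 * nstar + 64 * |n₀| + 1⌉₊ with hM
  have hMge : 4096 * σ + 32768 * nstar + 64 * |n₀| + 1 ≤ (M : ℝ) := Nat.le_ceil _
  have hM1 : (1 : ℝ) ≤ M := by
    have : 0 ≤ 4096 * σ + 32768 * nstar + 64 * |n₀| := by positivity
    linarith
  refine ⟨M ^ 4, fun K hK => ?_⟩
  have hK4 : (M : ℝ) ^ 4 ≤ (K : ℝ) := by exact_mod_cast hK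
  have hKpos : (0 : ℝ) < K := lt_of_lt_of_le (by positivity) hK4
  have hK14 : (M : ℝ) ≤ (K : ℝ) ^ (1 / 4 : ℝ) := by
    have hM4 : ((M : ℝ) ^ 4) ^ (1 / 4 : ℝ) = M := by
      rw [← Real.rpow_natCast, ← Real.rpow_mul (by positivity)]; norm_num
    calc (M : ℝ) = ((M : ℝ) ^ 4) ^ (1 / 4 : ℝ) := hM4.symm
      _ ≤ (K : ℝ) ^ (1 / 4 : ℝ) := Real.rpow_le_rpow (by positivity) hK4 (by norm_num)
  have hK34 : (M : ℝ) ^ 3 ≤ (K : ℝ) ^ (3 / 4 : ℝ) := by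
    have : (K : ℝ) ^ (3 / 4 : ℝ) = ((K : ℝ) ^ (1 / 4 : ℝ)) ^ 3 := by
      rw [← Real.rpow_natCast, ← Real.rpow_mul hKpos.le]; norm_num
    rw [this]
    exact pow_le_pow_left₀ (by positivity) hK14 3
  have hM3 : (M : ℝ) ≤ (M : ℝ) ^ 3 := by
    calc (M : ℝ) = M * 1 * 1 := by ring
      _ ≤ M * M * M := by gcongr
      _ = (M : ℝ) ^ 3 := by ring
  -- Step 2: `N₀`: `K^{1/4} t_N ≤ 1/2` eventually, and `N ≥ 1`
  obtain ⟨N₁, hN₁⟩ : ∃ N₁ : ℕ, ∀ N : ℕ, N₁ ≤ N →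
      (K : ℝ) ^ (1 / 4 : ℝ) * ((N + 1 : ℕ) : ℝ) ^ (-(1 / 3 : ℝ)) ≤ 1 / 2 := by
    have h1 : Tendsto (fun N : ℕ => ((N + 1 : ℕ) : ℝ)) atTop atTop :=
      tendsto_natCast_atTop_atTop.comp (tendsto_add_atTop_nat 1)
    have h2 : Tendsto (fun N : ℕ => ((N + 1 : ℕ) : ℝ) ^ (-(1 / 3 : ℝ))) atTop (𝓝 0) :=
      (tendsto_rpow_neg_atTop (by norm_num : (0 : ℝ) < 1 / 3)).comp h1
    have h3 : Tendsto (fun N : ℕ => (K : ℝ) ^ (1 / 4 : ℝ) * ((N + 1 : ℕ) : ℝ) ^ (-(1 / 3 : ℝ))) atTop (𝓝 0) := by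
      simpa using h2.const_mul ((K : ℝ) ^ (1 / 4 : ℝ))
    obtain ⟨N₁, hN₁⟩ := eventually_atTop.1 (h3.eventually (Iic_mem_nhds (by norm_num : (0 : ℝ) < 1 / 2)))
    exact ⟨N₁, fun N hN => hN₁ N hN⟩
  refine ⟨max N₁ 1, fun N hN => ?_⟩
  have hN₁' : N₁ ≤ N := (le_max_left _ _).trans hN
  have hN1 : 1 ≤ N := (le_max_right _ _).trans hN
  -- Step 3: notation and scale facts
  set tN : ℝ := ((N + 1 : ℕ) : ℝ) ^ (-(1 / 3 : ℝ)) with htN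
  set ε : ℝ := hsDiameter σ N with hε_def
  have hε : ε = σ * tN := rfl
  have htN0 : 0 < tN := Real.rpow_pos_of_pos (by positivity) _
  have hε0 : 0 < ε := hsDiameter_pos hσ N
  have hεσ : ε ≤ σ := hsDiameter_le hσ.le N
  have hε2 : ε < 1 / 2 := hεσ.trans_lt hσ2
  set r : ℝ := (K : ℝ) ^ (1 / 4 : ℝ) * tN with hr_def
  have hK140 : 0 < (K : ℝ) ^ (1 / 4 : ℝ) := Real.rpow_pos_of_pos hKpos _
  have hr0 : 0 < r := mul_pos hK140 htN0
  have hr2 : r ≤ 1 / 2 := hN₁ N hN₁'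
  have htN3 : tN ^ 3 * ((N : ℝ) + 1) = 1 := by
    have hN0' : (0 : ℝ) < ((N + 1 : ℕ) : ℝ) := by positivity
    have hcast : ((N + 1 : ℕ) : ℝ) = (N : ℝ) + 1 := by push_cast; ring
    have h1 : tN ^ 3 = (((N + 1 : ℕ) : ℝ))⁻¹ := by
      rw [htN, ← Real.rpow_natCast, ← Real.rpow_mul hN0'.le,
        show (-(1 / 3 : ℝ)) * ((3 : ℕ) : ℝ) = -1 by norm_num, Real.rpow_neg_one]
    rw [h1, hcast, inv_mul_cancel₀ (by positivity)]
  have hεr : ε ≤ r / 4 := by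
    rw [hε, hr_def]
    have : 4096 * σ ≤ (K : ℝ) ^ (1 / 4 : ℝ) := by
      have : 0 ≤ 32768 * nstar + 64 * |n₀| := by positivity
      linarith
    have hσK : σ ≤ (K : ℝ) ^ (1 / 4 : ℝ) / 4 := by linarith
    calc σ * tN ≤ (K : ℝ) ^ (1 / 4 : ℝ) / 4 * tN := mul_le_mul_of_nonneg_right hσK htN0.le
      _ = (K : ℝ) ^ (1 / 4 : ℝ) * tN / 4 := by ring
  set R : ℝ := r / 4 with hR_def
  have hR0 : 0 < R := by positivity
  have hR8 : R ≤ 1 / 8 := by rw [hR_def]; linarith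
  have hRε : 1024 * hsDiameter σ N ≤ R := by
    rw [hR_def, hr_def, ← hε_def, hε]
    have : 4096 * σ ≤ (K : ℝ) ^ (1 / 4 : ℝ) := by
      have : 0 ≤ 32768 * nstar + 64 * |n₀| := by positivity
      linarith
    calc 1024 * (σ * tN) = (4096 * σ) * tN / 4 := by ring
      _ ≤ (K : ℝ) ^ (1 / 4 : ℝ) * tN / 4 := by gcongr
  have hNR3 : ((N : ℝ) + 1) * R ^ 3 = (K : ℝ) ^ (3 / 4 : ℝ) / 64 := by
    have hK3 : ((K : ℝ) ^ (1 / 4 : ℝ)) ^ 3 = (K : ℝ) ^ (3 / 4 : ℝ) := by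
      rw [← Real.rpow_natCast, ← Real.rpow_mul hKpos.le]; norm_num
    rw [hR_def, hr_def, ← hK3]
    calc ((N : ℝ) + 1) * ((K : ℝ) ^ (1 / 4 : ℝ) * tN / 4) ^ 3
        = ((K : ℝ) ^ (1 / 4 : ℝ)) ^ 3 / 64 * (tN ^ 3 * ((N : ℝ) + 1)) := by ring
      _ = ((K : ℝ) ^ (1 / 4 : ℝ)) ^ 3 / 64 := by rw [htN3, mul_one]
  have hn₀R : n₀ ≤ ((N : ℝ) + 1) * R ^ 3 := by
    rw [hNR3]
    have : 64 * |n₀| ≤ (K : ℝ) ^ (3 / 4 : ℝ) := by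
      have h1 : 64 * |n₀| ≤ (M : ℝ) := by
        have : 0 ≤ 4096 * σ + 32768 * nstar := by positivity
        linarith
      exact h1.trans (hM3.trans hK34)
    have := le_abs_self n₀
    linarith
  have hTn : nstar ≤ ((N : ℝ) + 1) * R ^ 3 / 512 := by
    rw [hNR3]
    have : 32768 * nstar ≤ (K : ℝ) ^ (3 / 4 : ℝ) := by
      have h1 : 32768 * nstar ≤ (M : ℝ) := by
        have : 0 ≤ 4096 * σ + 64 * |n₀| := by positivity
        linarith
      exact h1.trans (hM3.trans hK34)
    linarith
  -- Step 4: a flow (Alexander) to phrase F1/F2, the Gibbs law and its disintegration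
  have hε2' : hsDiameter σ N < 2⁻¹ := by rw [← one_div]; exact hε2
  obtain ⟨Φ⟩ := HardSphereFlow.nonempty_torus_holds (d := Fin 3) hε0 hε2' (N + 1)
  set G : Measure (Config (N + 1) (Fin 3) T3) := localGibbsLaw σ (fun _ => 1) (fun _ => 0) (fun _ => θe) N Φ with hG
  set Ppos : Measure (Fin (N + 1) → T3) := posGibbsMeasure (fun _ : T3 => (1 : ℝ)) (hsDiameter σ N) (N + 1) with hPpos
  set γN : Measure (Fin (N + 1) → V3) := Measure.pi fun _ : Fin (N + 1) => gaussMeasure (0 : V3) θe with hγN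
  haveI hPprob : IsProbabilityMeasure Ppos :=
    isProbabilityMeasure_posGibbsMeasure continuous_const (fun _ => one_pos) (by linarith : σ ≤ 1 / 2) N
  haveI : IsProbabilityMeasure γN := by rw [hγN]; infer_instance
  -- the defect mark and its measurability
  set δf : Config (N + 1) (Fin 3) T3 → Fin (N + 1) → Fin (N + 1) → ℝ≥0∞ := fun w i j =>
    ENNReal.ofReal (1 - metroOddMark σ N (fun _ => 1) (fun _ => 1) (fun _ => 1) r ϑ 0 w i j) with hδf
  have hmOM : ∀ i j, Measurable fun w : Config (N + 1) (Fin 3) T3 =>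
      metroOddMark σ N (fun _ => 1) (fun _ => 1) (fun _ => 1) r ϑ 0 w i j := fun i j =>
    measurable_metroOddMark σ N continuous_const continuous_const continuous_const r ϑ 0 i j
  have hδm : ∀ i j, Measurable fun w => δf w i j := fun i j =>
    (measurable_const.sub (hmOM i j)).ennreal_ofReal
  have hδle : ∀ w i j, δf w i j ≤ 1 := by
    intro w i j
    simp only [hδf]
    refine ENNReal.ofReal_le_one.2 ?_
    have : 0 ≤ metroOddMark σ N (fun _ => 1) (fun _ => 1) (fun _ => 1) r ϑ 0 w i j := by
      rw [metroOddMark_one_eq]; exact minWeight_nonneg _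
    linarith
  -- F1 and F2
  have hflux1 := stub_fluxLeGibbs hσ hσ4 hθe N Φ hδm
  have hflux2 := stub_gibbsFluxLower hσ hσ4 hθe hN1 Φ
  -- the per-pair core inequality
  have core : ∀ i j : Fin (N + 1), i ≠ j →
      ∫⁻ z, ∫⁻ ω : Metric.sphere (0 : V3) 1,
          ENNReal.ofReal (hsDiameter σ N ^ 2 * ⟪((ω : V3)), (z i).2 - (z j).2⟫_ℝ) *
            δf (contactInsert (hsDiameter σ N) i j (ω : V3) z) i j ∂(volume : Measure V3).toSphere ∂G ≤
        (ENNReal.ofReal Bp + ENNReal.ofReal y₂) *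
          ∫⁻ z, ∫⁻ ω : Metric.sphere (0 : V3) 1,
            ENNReal.ofReal (hsDiameter σ N ^ 2 * ⟪((ω : V3)), (z i).2 - (z j).2⟫_ℝ) ∂(volume : Measure V3).toSphere ∂G := by
    intro i j hij
    -- abbreviations
    set sph : Measure (Metric.sphere (0 : V3) 1) := (volume : Measure V3).toSphere with hsph
    set We : Config (N + 1) (Fin 3) T3 → Metric.sphere (0 : V3) 1 → ℝ≥0∞ := fun z ω =>
      ENNReal.ofReal (hsDiameter σ N ^ 2 * ⟪((ω : V3)), (z i).2 - (z j).2⟫_ℝ) with hWe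
    -- measurability on `Config × sphere`
    have hWm : Measurable fun q : Config (N + 1) (Fin 3) T3 × Metric.sphere (0 : V3) 1 => We q.1 q.2 := by
      have hc : Continuous fun q : Config (N + 1) (Fin 3) T3 × Metric.sphere (0 : V3) 1 =>
          hsDiameter σ N ^ 2 * ⟪((q.2 : V3)), (q.1 i).2 - (q.1 j).2⟫_ℝ := by fun_prop
      exact hc.measurable.ennreal_ofReal
    have hFm : Measurable fun q : Config (N + 1) (Fin 3) T3 × Metric.sphere (0 : V3) 1 =>
        We q.1 q.2 * δf (contactInsert (hsDiameter σ N) i j (q.2 : V3) q.1) i j :=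
      hWm.mul ((hδm i j).comp (measurable_contactInsert_prod (hsDiameter σ N) i j))
    -- measurability along `(vs, ω) ↦ (zipConfig (xs, vs), ω)` for fixed positions
    have hzipm : ∀ xs : Fin (N + 1) → T3, Measurable fun q : (Fin (N + 1) → V3) × Metric.sphere (0 : V3) 1 =>
        ((zipConfig (xs, q.1) : Config (N + 1) (Fin 3) T3), q.2) := fun xs =>
      (measurable_zipConfig.comp (measurable_const.prodMk measurable_fst)).prodMk measurable_snd
    have hFxs : ∀ xs : Fin (N + 1) → T3, Measurable fun q : (Fin (N + 1) → V3) × Metric.sphere (0 : V3) 1 =>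
        We (zipConfig (xs, q.1)) q.2 * δf (contactInsert (hsDiameter σ N) i j (q.2 : V3) (zipConfig (xs, q.1))) i j := by
      intro xs
      have h := hFm.comp (hzipm xs)
      exact h
    have hWxs : ∀ xs : Fin (N + 1) → T3, Measurable fun q : (Fin (N + 1) → V3) × Metric.sphere (0 : V3) 1 =>
        We (zipConfig (xs, q.1)) q.2 := by
      intro xs
      have h := hWm.comp (hzipm xs)
      exact h
    -- rung-0 disintegration
    have hdisL : ∫⁻ z, ∫⁻ ω, We z ω * δf (contactInsert (hsDiameter σ N) i j (ω : V3) z) i j ∂sph ∂G =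
        ∫⁻ xs, ∫⁻ vs, ∫⁻ ω, We (zipConfig (xs, vs)) ω *
          δf (contactInsert (hsDiameter σ N) i j (ω : V3) (zipConfig (xs, vs))) i j ∂sph ∂γN ∂Ppos := by
      have hmeas : Measurable fun z : Config (N + 1) (Fin 3) T3 =>
          ∫⁻ ω, We z ω * δf (contactInsert (hsDiameter σ N) i j (ω : V3) z) i j ∂sph := by
        have h := hFm.lintegral_prod_right' (ν := sph)
        exact h
      have h := lintegral_localGibbsLaw_rung0 σ zero_le_one hθe 0 N Φ hmeas
      rw [hG, hγN, hPpos]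
      exact h
    have hdisR : ∫⁻ z, ∫⁻ ω, We z ω ∂sph ∂G = ∫⁻ xs, ∫⁻ vs, ∫⁻ ω, We (zipConfig (xs, vs)) ω ∂sph ∂γN ∂Ppos := by
      have hmeas : Measurable fun z : Config (N + 1) (Fin 3) T3 => ∫⁻ ω, We z ω ∂sph := by
        have h := hWm.lintegral_prod_right' (ν := sph)
        exact h
      have h := lintegral_localGibbsLaw_rung0 σ zero_le_one hθe 0 N Φ hmeas
      rw [hG, hγN, hPpos]
      exact h
    -- the position-free flux normalisation
    set Λ : ℝ≥0∞ := ∫⁻ ω, ∫⁻ vs, We (zipConfig ((fun _ => (0 : T3)), vs)) ω ∂γN ∂sph with hΛ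
    have hWfree : ∀ (xs : Fin (N + 1) → T3) vs ω, We (zipConfig (xs, vs)) ω = We (zipConfig ((fun _ => (0 : T3)), vs)) ω :=
      fun xs vs ω => rfl
    have hRin : ∀ xs : Fin (N + 1) → T3, ∫⁻ vs, ∫⁻ ω, We (zipConfig (xs, vs)) ω ∂sph ∂γN = Λ := by
      intro xs
      rw [lintegral_lintegral_swap (hWxs xs).aemeasurable]
      rfl
    -- occupancy events
    set cnt : (Fin (N + 1) → T3) → ℝ := fun xs =>
      ((Finset.univ.filter fun k : Fin (N + 1) => Torus.euclidDist (xs k) (xs j) < R).card : ℝ) with hcnt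
    set bad : Set (Fin (N + 1) → T3) := {xs | ¬ nstar < cnt xs} with hbad
    have hbad_sub : bad ⊆ {xs | cnt xs ≤ ((N : ℝ) + 1) * R ^ 3 / 512} := by
      intro xs hxs
      simp only [hbad, mem_setOf_eq, not_lt] at hxs
      exact hxs.trans hTn
    have hPbad : Ppos bad ≤ ENNReal.ofReal y₂ :=
      (measure_mono hbad_sub).trans (hn₀ hRε hR8 hn₀R j)
    -- the velocity-level bound, good and bad positions
    have hvel : ∀ (xs : Fin (N + 1) → T3) (ω : Metric.sphere (0 : V3) 1),
        ∫⁻ vs, We (zipConfig (xs, vs)) ω * δf (contactInsert (hsDiameter σ N) i j (ω : V3) (zipConfig (xs, vs))) i j ∂γN ≤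
          (ENNReal.ofReal Bp + bad.indicator (fun _ => (1 : ℝ≥0∞)) xs) *
            ∫⁻ vs, We (zipConfig (xs, vs)) ω ∂γN := by
      intro xs ω
      by_cases hgood : nstar < cnt xs
      · have hnot : xs ∉ bad := by simp [hbad, hgood]
        rw [indicator_of_notMem hnot, add_zero]
        have hcount : 2 + 2 / ρs < ((Finset.univ.filter fun k : Fin (N + 1) =>
            Torus.euclidDist (xs k) (xs j) < r / 4).card : ℝ) := by
          simpa only [hcnt, hR_def] using hgood
        have := defectVel_le hσ hσ2 hθe hϑ hr0 hεr hij ω xs hB0 hKB hρs0 hρs1 hcount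
        simpa only [hWe, hδf, hγN, hBp, zipConfig_apply] using this
      · have hmem : xs ∈ bad := by simp only [hbad, mem_setOf_eq]; exact hgood
        rw [indicator_of_mem hmem]
        calc ∫⁻ vs, We (zipConfig (xs, vs)) ω *
              δf (contactInsert (hsDiameter σ N) i j (ω : V3) (zipConfig (xs, vs))) i j ∂γN
            ≤ ∫⁻ vs, We (zipConfig (xs, vs)) ω ∂γN :=
              lintegral_mono fun vs => mul_le_of_le_one_right zero_le (hδle _ _ _)
          _ ≤ (ENNReal.ofReal Bp + 1) * ∫⁻ vs, We (zipConfig (xs, vs)) ω ∂γN := by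
              refine le_mul_of_one_le_left zero_le ?_
              exact le_add_self
    -- integrate the velocity bound over directions and positions
    have hinner : ∀ xs : Fin (N + 1) → T3,
        ∫⁻ vs, ∫⁻ ω, We (zipConfig (xs, vs)) ω *
          δf (contactInsert (hsDiameter σ N) i j (ω : V3) (zipConfig (xs, vs))) i j ∂sph ∂γN ≤
          (ENNReal.ofReal Bp + bad.indicator (fun _ => (1 : ℝ≥0∞)) xs) * Λ := by
      intro xs
      rw [lintegral_lintegral_swap (hFxs xs).aemeasurable]
      calc ∫⁻ ω, ∫⁻ vs, We (zipConfig (xs, vs)) ω *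
            δf (contactInsert (hsDiameter σ N) i j (ω : V3) (zipConfig (xs, vs))) i j ∂γN ∂sph
          ≤ ∫⁻ ω, (ENNReal.ofReal Bp + bad.indicator (fun _ => (1 : ℝ≥0∞)) xs) *
              ∫⁻ vs, We (zipConfig (xs, vs)) ω ∂γN ∂sph := lintegral_mono fun ω => hvel xs ω
        _ = (ENNReal.ofReal Bp + bad.indicator (fun _ => (1 : ℝ≥0∞)) xs) * Λ := by
            rw [lintegral_const_mul' _ _ (by
              refine ENNReal.add_ne_top.2 ⟨ENNReal.ofReal_ne_top, ?_⟩
              by_cases h : xs ∈ bad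
              · rw [indicator_of_mem h]; exact ENNReal.one_ne_top
              · rw [indicator_of_notMem h]; exact ENNReal.zero_ne_top)]
            rfl
    rw [hdisL, hdisR]
    simp_rw [hRin]
    rw [lintegral_const, measure_univ, mul_one]
    calc ∫⁻ xs, ∫⁻ vs, ∫⁻ ω, We (zipConfig (xs, vs)) ω *
          δf (contactInsert (hsDiameter σ N) i j (ω : V3) (zipConfig (xs, vs))) i j ∂sph ∂γN ∂Ppos
        ≤ ∫⁻ xs, (ENNReal.ofReal Bp + bad.indicator (fun _ => (1 : ℝ≥0∞)) xs) * Λ ∂Ppos := lintegral_mono hinner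
      _ = ∫⁻ xs, (ENNReal.ofReal Bp * Λ + bad.indicator (fun _ => Λ) xs) ∂Ppos := by
          refine lintegral_congr fun xs => ?_
          rw [add_mul]
          congr 1
          by_cases h : xs ∈ bad
          · rw [indicator_of_mem h, indicator_of_mem h, one_mul]
          · rw [indicator_of_notMem h, indicator_of_notMem h, zero_mul]
      _ = ENNReal.ofReal Bp * Λ + ∫⁻ xs, bad.indicator (fun _ => Λ) xs ∂Ppos := by
          rw [lintegral_add_left measurable_const, lintegral_const, measure_univ, mul_one]
      _ ≤ ENNReal.ofReal Bp * Λ + Λ * Ppos bad := add_le_add le_rfl (lintegral_indicator_const_le _ _)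
      _ ≤ ENNReal.ofReal Bp * Λ + Λ * ENNReal.ofReal y₂ := add_le_add le_rfl (mul_le_mul' le_rfl hPbad)
      _ = (ENNReal.ofReal Bp + ENNReal.ofReal y₂) * Λ := by ring
  -- Step 5: sum over pairs
  have hsum : (∑ i : Fin (N + 1), ∑ j : Fin (N + 1), if i = j then 0 else
        ∫⁻ z, ∫⁻ ω : Metric.sphere (0 : V3) 1,
            ENNReal.ofReal (hsDiameter σ N ^ 2 * ⟪((ω : V3)), (z i).2 - (z j).2⟫_ℝ) *
              δf (contactInsert (hsDiameter σ N) i j (ω : V3) z) i j ∂(volume : Measure V3).toSphere ∂G) ≤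
      (ENNReal.ofReal Bp + ENNReal.ofReal y₂) *
        ∑ i : Fin (N + 1), ∑ j : Fin (N + 1), if i = j then 0 else
          ∫⁻ z, ∫⁻ ω : Metric.sphere (0 : V3) 1,
            ENNReal.ofReal (hsDiameter σ N ^ 2 * ⟪((ω : V3)), (z i).2 - (z j).2⟫_ℝ) ∂(volume : Measure V3).toSphere ∂G := by
    rw [Finset.mul_sum]
    refine Finset.sum_le_sum fun i _ => ?_
    rw [Finset.mul_sum]
    refine Finset.sum_le_sum fun j _ => ?_
    by_cases hij : i = j
    · simp [hij]
    · rw [if_neg hij, if_neg hij]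
      exact core i j hij
  have hfin : 2 * ((ENNReal.ofReal Bp + ENNReal.ofReal y₂) * (2 *
      outgoingCollisionFlux (hsDiameter σ N) (N + 1)
        (fun w _ _ => ENNReal.ofReal (canonicalDensity (Torus.geometry (Fin 3)) (hsDiameter σ N) (N + 1)
          (localGibbsProfile (fun _ => 1) (fun _ => 0) (fun _ => θe)) w)))) ≤
      ENNReal.ofReal y * outgoingCollisionFlux (hsDiameter σ N) (N + 1)
        (fun w _ _ => ENNReal.ofReal (canonicalDensity (Torus.geometry (Fin 3)) (hsDiameter σ N) (N + 1)
          (localGibbsProfile (fun _ => 1) (fun _ => 0) (fun _ => θe)) w)) := by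
    rw [← mul_assoc, ← mul_assoc]
    refine mul_le_mul' ?_ le_rfl
    rw [← ENNReal.ofReal_add hBp0 hy₂0.le, show (2 : ℝ≥0∞) = ENNReal.ofReal 2 by norm_num,
      ← ENNReal.ofReal_mul (by norm_num), ← ENNReal.ofReal_mul (by positivity)]
    refine ENNReal.ofReal_le_ofReal ?_
    rw [hy₂] at hBpy ⊢
    linarith
  calc outgoingCollisionFlux (hsDiameter σ N) (N + 1)
        (fun w i j => ENNReal.ofReal (canonicalDensity (Torus.geometry (Fin 3)) (hsDiameter σ N) (N + 1)
          (localGibbsProfile (fun _ => 1) (fun _ => 0) (fun _ => θe)) w) * δf w i j)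
      ≤ _ := hflux1
    _ ≤ 2 * ((ENNReal.ofReal Bp + ENNReal.ofReal y₂) *
        ∑ i : Fin (N + 1), ∑ j : Fin (N + 1), if i = j then 0 else
          ∫⁻ z, ∫⁻ ω : Metric.sphere (0 : V3) 1,
            ENNReal.ofReal (hsDiameter σ N ^ 2 * ⟪((ω : V3)), (z i).2 - (z j).2⟫_ℝ) ∂(volume : Measure V3).toSphere ∂G) :=
        mul_le_mul' le_rfl hsum
    _ ≤ 2 * ((ENNReal.ofReal Bp + ENNReal.ofReal y₂) * (2 *
      outgoingCollisionFlux (hsDiameter σ N) (N + 1)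
        (fun w _ _ => ENNReal.ofReal (canonicalDensity (Torus.geometry (Fin 3)) (hsDiameter σ N) (N + 1)
          (localGibbsProfile (fun _ => 1) (fun _ => 0) (fun _ => θe)) w)))) := by gcongr
    _ ≤ _ := hfin

end Summit.AtomisticToContinuum.HydrodynamicLimit.Theorems.OddContactSymmetryKineticSlab

end
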